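import Literature.AlgebraicGeometry.AbelianSchemes.PolarizedAbelianSchemeWithLevelBaseChange
import Literature.AlgebraicGeometry.AbelianSchemes.RigidifiedLineBundleComapHom
import Literature.AlgebraicGeometry.AbelianSchemes.AbelianSchemeDualTransportUnit
import Literature.AlgebraicGeometry.AbelianSchemes.AbelianSchemeOverRestrictPt
import Literature.AlgebraicGeometry.AbelianSchemes.AbelianSchemeOverFibreDim
import Literature.AlgebraicGeometry.Morphisms.GeometricPointsLiftSurjective
import Literature.AlgebraicGeometry.Limits.SurjectiveSpread
import HarnessLib

/-!
# The fibre-at-`𝟙` homomorphism of an `S`-homomorphism of abelian schemes, read on points of the total spaces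
# ([MumfordFogartyKirwan1994] Ch. 6 §1–§2, Ch. 7 §2 Def. 7.1; [GortzWedhorn2020] (4.7); [MumfordAV1970] §7 Thm. 4)

Topic `AlgebraicGeometry/AbelianSchemes`; namespaces `Literature.AlgebraicGeometry.AbelianSchemes.AbelianSchemeOver` (§1–§2)
and `….PolarizedAbelianSchemeWithLevel` (§3).  KERNEL ONLY: theorems; no definition, no named fact, no instance, no `sorry`.

For an abelian scheme `A → S` and a field-valued point `s : Spec Ω → S`, the FIBRE-AT-`𝟙` MODEL of the fibre is
`((A ×_S Spec Ω) ×_{Spec Ω} 𝟙)` — `((A.baseChange s).fibre (𝟙 _)).toAbelianVariety` — the model in which a TRIPLE over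
`Spec Ω` (`P.baseChange s`) is read by ★ `isAdmissibleAt_heckeQuotient` / `IsAdmissibleAt` (cell hodgecm-mathlib,
Hecke-link line, socket (B), node H4-ALG; consumer = the H4 assembler).  For an `S`-homomorphism `f : A → B` the induced
homomorphism of these models is `f_s¹ := fibreHom (baseChangeHom f s) (𝟙 _)` (★ `fibreHom`, ★ B-p19 `baseChangeHom` with
`haveI := isMonHom_baseChangeHom f s` — the `IsMonHom` instance of `(Over.pullback s).map f` is not found on the
`baseChange` carriers by instance search, so every statement carries the term-mode `haveI`).  Everything is read through
the (injective) POINT OF THE TOTAL SPACE `P ↦ fibrePointToLeft (𝟙) P ≫ pr_A : Spec Ω → A`: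

* §1 `fibrePointToLeft_fst_injective`, `fibrePointToLeft_fst_comp_hom`, `exists_fibrePointToLeft_fst_eq` (every point of
  `A` over `s` occurs), `fibrePointToLeft_fst_one` (`1 ↦ s ≫ ε_A`), `fibrePointToLeft_fst_restrictPt_sectionBaseChange`
  (`(τ ×_S Spec Ω)(𝟙) ↦ s ≫ τ`);
* §2 `fibrePointToLeft_fst_map_fibreHom_baseChangeHom` (`f_s¹ P ↦ (point of P) ≫ f`), **`algPointsMap_fibreHom_baseChangeHom_surjective`**
  (`f` surjective + l.f.t., `Ω` algebraically closed ⇒ `f_s¹` onto on `Ω`-points — ★ `Morphisms.exists_over_comp_eq_of_surjective`),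
  **`isDominant_fibreHom_baseChangeHom`** (★ `Limits.surjective_pullback_map_left` twice), `dim_fibre_baseChange_id`, and the
  KERNEL TRANSPORT **`algPointsMap_fibreHom_baseChangeHom_eq_one_iff`**: kernel of `f` on fibre points over `s` = the
  restrictions of a family of sections `τ_c`, `c ∈ K₀` ⇒ kernel of `f_s¹` on `Ω`-points = the points `(τ_c ×_S Spec Ω)(𝟙)`;
* §3 the same in the binders of triples `P′, Q` and an `S`-homomorphism `ψ : P′.A → Q.A`, kernel indexed by the level
  sections `P′.level.section_ c` (★ `sectionBaseChange_sectionPow`): the (dim)/(S)/(dominant)/(K-alg) inputs of the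
  pointwise theorem at `(P′.baseChange s, Q.baseChange s, ψ_s¹)`.  (L) is B-p17 (g10)'s ★-to-be `SectionBaseChangeAlongHom`;
  (W‴) is the (T3b) engine's; the `A.fibre s`-model twins are B-p04 (g17)'s ★-to-be `FibreHomPointsOfFibrePoints`.

Presearch: [MumfordFogartyKirwan1994] Ch. 6 §1 Def. 6.1, §2 Def. 6.3, Ch. 7 §2 Def. 7.1 (held), [GortzWedhorn2020] (4.7),
Cor. 3.36 (held), [MumfordAV1970] §7 Thm. 4 (held); tree: ★ `fibreHom` / `fibrePointToLeft_*` / `restrictPt_*` /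
`sectionBaseChange_*` (the `A.fibre s` model and the base-change dictionary; the fibre-at-`𝟙` readings were absent).
HC_CM is proved only modulo the 7 printed citations until rung 0 closes; this file discharges none of them.

## References
* [MumfordFogartyKirwan1994] D. Mumford, J. Fogarty, F. Kirwan, *Geometric Invariant Theory*, 3rd ed. (1994), Ch. 6 §1
  Def. 6.1 (p. 115), §2 Def. 6.3 (p. 120); Ch. 7 §2 Def. 7.1 (p. 129).
* [GortzWedhorn2020] U. Görtz, T. Wedhorn, *Algebraic Geometry I*, 2nd ed. (2020), Section (4.7) (pp. 107–108), Cor. 3.36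
  (p. 83), Remark 16.54 (p. 539).
* [MumfordAV1970] D. Mumford, *Abelian Varieties* (1970), §7 Thm. 4 (p. 72).
-/

set_option autoImplicit false

noncomputable section

open CategoryTheory CategoryTheory.Limits AlgebraicGeometry

universe u

namespace Literature.AlgebraicGeometry.AbelianSchemes.AbelianSchemeOver

open Literature.AlgebraicGeometry.Motives
open scoped MonObj

variable {S : Scheme.{u}} {A B : AbelianSchemeOver S} {Ω : Type u} [Field Ω]

/-! ### §1 Points of the fibre-at-`𝟙` model `(A ×_S Spec Ω)_{𝟙}` read in the total space `A` -/

/-- **An `Ω`-point of the fibre-at-`𝟙` model `(A ×_S Spec Ω)_{𝟙}` is determined by its point of `A`**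
(`P ↦ fibrePointToLeft (𝟙) P ≫ pr_A` is injective: ★ `fibrePointToLeft_injective` and `pullback.hom_ext`, the second
projection of a point over `𝟙` being `𝟙`). [cite: GortzWedhorn2020, Section (4.7) (pp. 107–108)] -/
theorem fibrePointToLeft_fst_injective (A : AbelianSchemeOver S) (s : Spec (.of Ω) ⟶ S) :
    Function.Injective (fun P : ((A.baseChange s).fibre (𝟙 (Spec (.of Ω)))).toAbelianVariety.Points Ω =>
      (A.baseChange s).fibrePointToLeft (𝟙 _) P ≫ pullback.fst A.X.hom s) := by
  intro P Q h
  apply (A.baseChange s).fibrePointToLeft_injective (𝟙 _)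
  apply pullback.hom_ext
  · exact h
  · exact ((A.baseChange s).fibrePointToLeft_comp_hom (𝟙 _) P).trans
      ((A.baseChange s).fibrePointToLeft_comp_hom (𝟙 _) Q).symm

/-- The point of `A` under an `Ω`-point of `(A ×_S Spec Ω)_{𝟙}` lies over `s`. [cite: GortzWedhorn2020, Section (4.7) (pp. 107–108)] -/
theorem fibrePointToLeft_fst_comp_hom (A : AbelianSchemeOver S) (s : Spec (.of Ω) ⟶ S)
    (P : ((A.baseChange s).fibre (𝟙 (Spec (.of Ω)))).toAbelianVariety.Points Ω) :
    ((A.baseChange s).fibrePointToLeft (𝟙 _) P ≫ pullback.fst A.X.hom s) ≫ A.X.hom = s :=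
  calc ((A.baseChange s).fibrePointToLeft (𝟙 _) P ≫ pullback.fst A.X.hom s) ≫ A.X.hom
      = (A.baseChange s).fibrePointToLeft (𝟙 _) P ≫ (pullback.fst A.X.hom s ≫ A.X.hom) := Category.assoc _ _ _
    _ = (A.baseChange s).fibrePointToLeft (𝟙 _) P ≫ (pullback.snd A.X.hom s ≫ s) :=
        congrArg ((A.baseChange s).fibrePointToLeft (𝟙 _) P ≫ ·) pullback.condition
    _ = ((A.baseChange s).fibrePointToLeft (𝟙 _) P ≫ (A.baseChange s).X.hom) ≫ s := (Category.assoc _ _ _).symm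
    _ = 𝟙 _ ≫ s := congrArg (· ≫ s) ((A.baseChange s).fibrePointToLeft_comp_hom (𝟙 _) P)
    _ = s := Category.id_comp _

/-- **Every point `z : Spec Ω → A` over `s` is the point of `A` under an `Ω`-point of `(A ×_S Spec Ω)_{𝟙}`** (the
section `((z, 𝟙), 𝟙)` of the iterated fibre product). [cite: GortzWedhorn2020, Section (4.7) (pp. 107–108)] -/
theorem exists_fibrePointToLeft_fst_eq (A : AbelianSchemeOver S) (s : Spec (.of Ω) ⟶ S)
    (z : Spec (.of Ω) ⟶ A.X.left) (hz : z ≫ A.X.hom = s) :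
    ∃ P : ((A.baseChange s).fibre (𝟙 (Spec (.of Ω)))).toAbelianVariety.Points Ω,
      (A.baseChange s).fibrePointToLeft (𝟙 _) P ≫ pullback.fst A.X.hom s = z := by
  have hz' : z ≫ A.X.hom = 𝟙 _ ≫ s := by rw [hz, Category.id_comp]
  let x₀ : Spec (.of Ω) ⟶ (A.baseChange s).X.left := pullback.lift z (𝟙 _) hz'
  have hx₀ : x₀ ≫ (A.baseChange s).X.hom = 𝟙 _ := pullback.lift_snd _ _ _
  have hx₀' : x₀ ≫ (A.baseChange s).X.hom = 𝟙 _ ≫ 𝟙 _ := by rw [hx₀, Category.id_comp]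
  refine ⟨AlgPoints.mk (pullback.lift x₀ (𝟙 _) hx₀') ?_, ?_⟩
  · change pullback.lift x₀ (𝟙 _) hx₀' ≫ pullback.snd _ _ = _
    rw [pullback.lift_snd, Algebra.algebraMap_self, CommRingCat.ofHom_id, Spec.map_id]
  · change (pullback.lift x₀ (𝟙 _) hx₀' ≫ pullback.fst _ _) ≫ pullback.fst A.X.hom s = z
    rw [pullback.lift_fst]
    exact pullback.lift_fst _ _ _

/-- The point of `A` under the unit `Ω`-point of `(A ×_S Spec Ω)_{𝟙}` is `s ≫ ε_A` (★ `fibrePointToLeft_one` and the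
pulled-back unit section ★ `sectionBaseChange_left_comp_fst`). [cite: MumfordFogartyKirwan1994, Ch. 6 §1 Definition 6.1 (p. 115)] -/
theorem fibrePointToLeft_fst_one (A : AbelianSchemeOver S) (s : Spec (.of Ω) ⟶ S) :
    (A.baseChange s).fibrePointToLeft (𝟙 _) (1 : ((A.baseChange s).fibre (𝟙 (Spec (.of Ω)))).toAbelianVariety.Points Ω) ≫
      pullback.fst A.X.hom s = s ≫ A.unitSection := by
  rw [DualPair.fibrePointToLeft_one (A := A.baseChange s) (𝟙 _), Category.id_comp]
  exact A.sectionBaseChange_left_comp_fst s η[A.X]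

/-- The point of `A` under `(τ ×_S Spec Ω)(𝟙)`, for a section `τ` of `A → S`, is `s ≫ τ` (★ `restrictPt_left_fst`, ★
`sectionBaseChange_left_comp_fst`) — Mumford's «the images `σᵢ(s)`» in the fibre-at-`𝟙` model.
[cite: MumfordFogartyKirwan1994, Ch. 7 §2 Definition 7.1 (p. 129)] -/
theorem fibrePointToLeft_fst_restrictPt_sectionBaseChange (A : AbelianSchemeOver S) (s : Spec (.of Ω) ⟶ S)
    (τ : A.Sections) :
    (A.baseChange s).fibrePointToLeft (𝟙 _) ((A.baseChange s).restrictPt (𝟙 (Spec (.of Ω))) (A.sectionBaseChange s τ)) ≫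
      pullback.fst A.X.hom s = s ≫ τ.left := by
  have h1 : (A.baseChange s).fibrePointToLeft (𝟙 _) ((A.baseChange s).restrictPt (𝟙 (Spec (.of Ω))) (A.sectionBaseChange s τ)) =
      𝟙 _ ≫ (A.sectionBaseChange s τ).left := (A.baseChange s).restrictPt_left_fst (𝟙 _) (A.sectionBaseChange s τ)
  rw [h1]
  exact (congrArg (· ≫ pullback.fst A.X.hom s) (Category.id_comp _)).trans (A.sectionBaseChange_left_comp_fst s τ)

/-! ### §2 The fibre-at-`𝟙` homomorphism `f_s¹ := (f ×_S Spec Ω)_{𝟙}` of an `S`-homomorphism `f : A → B` -/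

/-- **`f_s¹` on points of the total spaces**: the point of `B` under `f_s¹(P)` is the point of `A` under `P` followed by
`f` (★ `fibrePointToLeft_map_fibreHom` + ★ `Limits.pullback_map_left_comp_fst`), where
`f_s¹ := fibreHom (baseChangeHom f s) (𝟙 _)` is the homomorphism of the fibre-at-`𝟙` models induced by the
`S`-homomorphism `f` (Mumford's induced homomorphism on geometric fibres). [cite: MumfordFogartyKirwan1994, Ch. 6 §2 Definition 6.3 (p. 120)] -/
theorem fibrePointToLeft_fst_map_fibreHom_baseChangeHom (f : A.X ⟶ B.X) [IsMonHom f] (s : Spec (.of Ω) ⟶ S)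
    (P : ((A.baseChange s).fibre (𝟙 (Spec (.of Ω)))).toAbelianVariety.Points Ω) :
    haveI := isMonHom_baseChangeHom f s
    (B.baseChange s).fibrePointToLeft (𝟙 _) (AlgPoints.map (fibreHom (baseChangeHom f s) (𝟙 (Spec (.of Ω)))).hom.hom.hom P) ≫
        pullback.fst B.X.hom s =
      ((A.baseChange s).fibrePointToLeft (𝟙 _) P ≫ pullback.fst A.X.hom s) ≫ f.left := by
  haveI := isMonHom_baseChangeHom f s
  calc (B.baseChange s).fibrePointToLeft (𝟙 _) (AlgPoints.map (fibreHom (baseChangeHom f s) (𝟙 (Spec (.of Ω)))).hom.hom.hom P) ≫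
        pullback.fst B.X.hom s
      = ((A.baseChange s).fibrePointToLeft (𝟙 _) P ≫ (baseChangeHom f s).left) ≫ pullback.fst B.X.hom s :=
        congrArg (· ≫ pullback.fst B.X.hom s) (fibrePointToLeft_map_fibreHom (baseChangeHom f s) (𝟙 _) P)
    _ = (A.baseChange s).fibrePointToLeft (𝟙 _) P ≫ ((baseChangeHom f s).left ≫ pullback.fst B.X.hom s) :=
        Category.assoc _ _ _
    _ = (A.baseChange s).fibrePointToLeft (𝟙 _) P ≫ (pullback.fst A.X.hom s ≫ f.left) :=
        congrArg ((A.baseChange s).fibrePointToLeft (𝟙 _) P ≫ ·)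
          (Literature.AlgebraicGeometry.Limits.pullback_map_left_comp_fst s f)
    _ = ((A.baseChange s).fibrePointToLeft (𝟙 _) P ≫ pullback.fst A.X.hom s) ≫ f.left := (Category.assoc _ _ _).symm

/-- **A surjective `S`-homomorphism is onto on the `Ω`-points of the fibre-at-`𝟙` models** (`Ω` algebraically closed,
`f` locally of finite type): every `Ω`-point of `(B ×_S Spec Ω)_{𝟙}` is `f_s¹` of one of `(A ×_S Spec Ω)_{𝟙}` — lift its
point of `B` along `f` (★ `Morphisms.exists_over_comp_eq_of_surjective`) and compare points of `B`.  The (S) input of ★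
`isAdmissibleAt_heckeQuotient`. [cite: GortzWedhorn2020, Cor. 3.36 (p. 83)] [cite: MumfordAV1970, §7 Thm. 4 (p. 72)] -/
theorem algPointsMap_fibreHom_baseChangeHom_surjective [IsAlgClosed Ω] (f : A.X ⟶ B.X) [IsMonHom f]
    [Surjective f.left] [LocallyOfFiniteType f.left] (s : Spec (.of Ω) ⟶ S) :
    haveI := isMonHom_baseChangeHom f s
    Function.Surjective (AlgPoints.map (L := Ω) (fibreHom (baseChangeHom f s) (𝟙 (Spec (.of Ω)))).hom.hom.hom :
      ((A.baseChange s).fibre (𝟙 _)).toAbelianVariety.Points Ω → ((B.baseChange s).fibre (𝟙 _)).toAbelianVariety.Points Ω) := by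
  haveI := isMonHom_baseChangeHom f s
  intro P
  -- the point of `B` under `P` lies over `s`; lift it along the surjective `f`
  obtain ⟨x, hx⟩ := Morphisms.exists_over_comp_eq_of_surjective f s
    (Over.homMk ((B.baseChange s).fibrePointToLeft (𝟙 _) P ≫ pullback.fst B.X.hom s)
      (B.fibrePointToLeft_fst_comp_hom s P) : Over.mk s ⟶ B.X)
  have hxz : x.left ≫ f.left = (B.baseChange s).fibrePointToLeft (𝟙 _) P ≫ pullback.fst B.X.hom s :=
    congrArg Over.Hom.left hx
  obtain ⟨P₀, hP₀⟩ := A.exists_fibrePointToLeft_fst_eq s x.left (Over.w x)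
  exact ⟨P₀, B.fibrePointToLeft_fst_injective s
    ((fibrePointToLeft_fst_map_fibreHom_baseChangeHom f s P₀).trans ((congrArg (· ≫ f.left) hP₀).trans hxz))⟩

/-- **A surjective `S`-homomorphism has dominant fibre-at-`𝟙` homomorphisms** (surjectivity is stable under the two base
changes, ★ `Limits.surjective_pullback_map_left`; surjective ⇒ dominant).  The `IsDominant` input of ★
`isAdmissibleAt_heckeQuotient`. [cite: GortzWedhorn2020, Section (4.7) (pp. 107–108)] -/
theorem isDominant_fibreHom_baseChangeHom (f : A.X ⟶ B.X) [IsMonHom f] [Surjective f.left]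
    (s : Spec (.of Ω) ⟶ S) :
    haveI := isMonHom_baseChangeHom f s
    IsDominant (fibreHom (baseChangeHom f s) (𝟙 (Spec (.of Ω)))).hom.hom.hom.left := by
  haveI := isMonHom_baseChangeHom f s
  haveI : Surjective (baseChangeHom f s).left := Literature.AlgebraicGeometry.Limits.surjective_pullback_map_left s f
  haveI : Surjective ((Over.pullback (𝟙 (Spec (.of Ω)))).map (baseChangeHom f s)).left :=
    Literature.AlgebraicGeometry.Limits.surjective_pullback_map_left _ _
  change IsDominant ((Over.pullback (𝟙 (Spec (.of Ω)))).map (baseChangeHom f s)).left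
  infer_instance

/-- The fibre-at-`𝟙` model of an abelian scheme of relative dimension `g` has dimension `g` (★ `dim_fibre_of_isOfRelDim`
after ★ `IsOfRelDim.baseChange`). [cite: GortzWedhorn2020, Remark 16.54 (p. 539)] -/
theorem dim_fibre_baseChange_id {g : ℕ} (h : A.IsOfRelDim g) (s : Spec (.of Ω) ⟶ S) :
    ((A.baseChange s).fibre (𝟙 (Spec (.of Ω)))).toAbelianVariety.dim = g :=
  (A.baseChange s).dim_fibre_of_isOfRelDim (h.baseChange s) (𝟙 _)

/-! #### §2′ The kernel of `f_s¹` on `Ω`-points from the kernel of `f` on geometric fibre points -/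

/-- **KERNEL TRANSPORT to the fibre-at-`𝟙` model**: if the kernel of the `S`-homomorphism `f` on fibre points over `s`
(`x : Spec Ω → A` over `s` with `x ≫ f = 1`) is exactly the set of restrictions `τ_c(s)` of a family of sections `τ_c`,
`c ∈ K₀`, then the kernel of `f_s¹` on `Ω`-points of `(A ×_S Spec Ω)_{𝟙}` is exactly the set of points
`(τ_c ×_S Spec Ω)(𝟙)`, `c ∈ K₀` — both read through the (injective) point of the total space.  For `f` the quotient by a
finite constant subgroup this is Mumford's «the kernel of `X → X/K` is `K`» on geometric fibres.
[cite: MumfordAV1970, §7 Thm. 4 (p. 72)] [cite: MumfordFogartyKirwan1994, Ch. 7 §2 Definition 7.1 (p. 129)] -/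
theorem algPointsMap_fibreHom_baseChangeHom_eq_one_iff {I : Type*} (f : A.X ⟶ B.X) [IsMonHom f]
    (s : Spec (.of Ω) ⟶ S) (K₀ : Set I) (τ : I → A.Sections)
    (hker : ∀ x : A.FibrePoints s, x ≫ f = 1 ↔ ∃ c ∈ K₀, x = A.restrict s (τ c))
    (P : ((A.baseChange s).fibre (𝟙 (Spec (.of Ω)))).toAbelianVariety.Points Ω) :
    haveI := isMonHom_baseChangeHom f s
    AlgPoints.map (fibreHom (baseChangeHom f s) (𝟙 (Spec (.of Ω)))).hom.hom.hom P = 1 ↔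
      ∃ c ∈ K₀, P = (A.baseChange s).restrictPt (𝟙 (Spec (.of Ω))) (A.sectionBaseChange s (τ c)) := by
  haveI := isMonHom_baseChangeHom f s
  -- the point of `A` under `P`, as a fibre point over `s`
  let xP : A.FibrePoints s :=
    Over.homMk ((A.baseChange s).fibrePointToLeft (𝟙 _) P ≫ pullback.fst A.X.hom s) (A.fibrePointToLeft_fst_comp_hom s P)
  have hxP : xP.left = (A.baseChange s).fibrePointToLeft (𝟙 _) P ≫ pullback.fst A.X.hom s := rfl
  -- `f_s¹ P = 1 ↔ xP ≫ f = 1`: both say that the point of `B` under `P ≫ f` is `s ≫ ε_B`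
  have h1 : AlgPoints.map (fibreHom (baseChangeHom f s) (𝟙 (Spec (.of Ω)))).hom.hom.hom P = 1 ↔ xP ≫ f = 1 := by
    constructor
    · intro h
      apply Over.OverMorphism.ext
      exact (fibrePointToLeft_fst_map_fibreHom_baseChangeHom f s P).symm.trans
        ((congrArg (fun Q => (B.baseChange s).fibrePointToLeft (𝟙 _) Q ≫ pullback.fst B.X.hom s) h).trans
          (B.fibrePointToLeft_fst_one s))
    · intro h
      exact B.fibrePointToLeft_fst_injective s ((fibrePointToLeft_fst_map_fibreHom_baseChangeHom f s P).trans
        ((congrArg Over.Hom.left h).trans (B.fibrePointToLeft_fst_one s).symm))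
  -- `xP = τ(s) ↔ P = τ_{Spec Ω}(𝟙)`: both say that the point of `A` under `P` is `s ≫ τ`
  have h2 : ∀ c, xP = A.restrict s (τ c) ↔ P = (A.baseChange s).restrictPt (𝟙 _) (A.sectionBaseChange s (τ c)) := by
    intro c
    constructor
    · intro h
      exact A.fibrePointToLeft_fst_injective s
        ((congrArg Over.Hom.left h).trans (A.fibrePointToLeft_fst_restrictPt_sectionBaseChange s (τ c)).symm)
    · intro h
      apply Over.OverMorphism.ext
      exact (congrArg (fun Q => (A.baseChange s).fibrePointToLeft (𝟙 _) Q ≫ pullback.fst A.X.hom s) h).trans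
        (A.fibrePointToLeft_fst_restrictPt_sectionBaseChange s (τ c))
  rw [h1, hker xP]
  exact exists_congr fun c => and_congr_right fun _ => h2 c

end Literature.AlgebraicGeometry.AbelianSchemes.AbelianSchemeOver

/-! ### §3 The pointwise data of an `S`-homomorphism between triples, in the input shapes of ★ `isAdmissibleAt_heckeQuotient` -/

namespace Literature.AlgebraicGeometry.AbelianSchemes.PolarizedAbelianSchemeWithLevel

open Literature.AlgebraicGeometry.Motives AbelianSchemeOver
open scoped MonObj


variable {S : Scheme.{u}} {g N N' : ℕ} {δ δ' : Fin g → ℕ} {Ω : Type u} [Field Ω]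
  (P' : PolarizedAbelianSchemeWithLevel g N' δ' S) (Q : PolarizedAbelianSchemeWithLevel g N δ S)
  (ψ : P'.A.X ⟶ Q.A.X) [IsMonHom ψ] (s : Spec (.of Ω) ⟶ S)

/-- (dim) for triples: the fibre-at-`𝟙` model of `Q ×_S s` has dimension `g` (`Q.relDim`). [cite: GortzWedhorn2020, Remark 16.54 (p. 539)] -/
theorem dim_fibre_baseChange_id : ((Q.baseChange s).A.fibre (𝟙 (Spec (.of Ω)))).toAbelianVariety.dim = g :=
  AbelianSchemeOver.dim_fibre_baseChange_id Q.relDim s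

/-- (S) for triples: a surjective `S`-homomorphism `ψ : P′.A → Q.A` is onto on the `Ω`-points of the fibre-at-`𝟙` models.
[cite: MumfordAV1970, §7 Thm. 4 (p. 72)] [cite: GortzWedhorn2020, Cor. 3.36 (p. 83)] -/
theorem algPointsMap_fibreHom_baseChangeHom_surjective [IsAlgClosed Ω] [Surjective ψ.left] [LocallyOfFiniteType ψ.left] :
    haveI := isMonHom_baseChangeHom ψ s
    Function.Surjective (AlgPoints.map (L := Ω) (fibreHom (baseChangeHom ψ s) (𝟙 (Spec (.of Ω)))).hom.hom.hom :
      ((P'.baseChange s).A.fibre (𝟙 _)).toAbelianVariety.Points Ω → ((Q.baseChange s).A.fibre (𝟙 _)).toAbelianVariety.Points Ω) :=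
  AbelianSchemeOver.algPointsMap_fibreHom_baseChangeHom_surjective ψ s

/-- (dominant) for triples: a surjective `S`-homomorphism `ψ : P′.A → Q.A` has dominant fibre-at-`𝟙` homomorphisms.
[cite: GortzWedhorn2020, Section (4.7) (pp. 107–108)] -/
theorem isDominant_fibreHom_baseChangeHom [Surjective ψ.left] :
    haveI := isMonHom_baseChangeHom ψ s
    IsDominant (fibreHom (baseChangeHom ψ s) (𝟙 (Spec (.of Ω)))).hom.hom.hom.left :=
  AbelianSchemeOver.isDominant_fibreHom_baseChangeHom ψ s

/-- **(K-alg) for triples, in LEVEL-SECTION form**: if the kernel of `ψ : P′.A → Q.A` on fibre points over `s` is the set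
of restrictions of the level sections `P′.level.section_ c = σ^c`, `c ∈ K₀ ⊆ (ℤ/N′)^{2g}`, then the kernel of `ψ_s¹` on
`Ω`-points is `{(P′ ×_S s).level.section_ c (𝟙) | c ∈ K₀}` (★ `sectionBaseChange_sectionPow`: the pulled-back level
structure has sections `σ^c ×_S Spec Ω`) — the (K-alg) input shape of the section-kernel edition of ★
`isAdmissibleAt_heckeQuotient`. [cite: MumfordAV1970, §7 Thm. 4 (p. 72)] [cite: MumfordFogartyKirwan1994, Ch. 7 §2 Definition 7.1 (p. 129)] -/
theorem algPointsMap_fibreHom_baseChangeHom_eq_one_iff (K₀ : Set (Fin g ⊕ Fin g → ZMod N'))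
    (hker : ∀ x : P'.A.FibrePoints s, x ≫ ψ = 1 ↔ ∃ c ∈ K₀, x = P'.A.restrict s (P'.level.section_ c))
    (P : ((P'.baseChange s).A.fibre (𝟙 (Spec (.of Ω)))).toAbelianVariety.Points Ω) :
    haveI := isMonHom_baseChangeHom ψ s
    AlgPoints.map (fibreHom (baseChangeHom ψ s) (𝟙 (Spec (.of Ω)))).hom.hom.hom P = 1 ↔
      ∃ c ∈ K₀, P = (P'.baseChange s).A.restrictPt (𝟙 (Spec (.of Ω))) ((P'.baseChange s).level.section_ c) := by
  have h := AbelianSchemeOver.algPointsMap_fibreHom_baseChangeHom_eq_one_iff ψ s K₀ (fun c => P'.level.section_ c) hker P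
  have hsec : ∀ c, (P'.baseChange s).level.section_ c = P'.A.sectionBaseChange s (P'.level.section_ c) := fun c =>
    (P'.A.sectionBaseChange_sectionPow s P'.level.σ c).symm
  simp only [hsec]
  exact h

end Literature.AlgebraicGeometry.AbelianSchemes.PolarizedAbelianSchemeWithLevel

end
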